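import Summits.ResolutionOfSingularities.ResolutionOfSingularities.Theses.MaxContactCut
import Summits.ResolutionOfSingularities.ResolutionOfSingularities.Theorems.BoundaryLedgerClasses
import Summits.ResolutionOfSingularities.ResolutionOfSingularities.Theorems.MaxContactCutItineraryCut
import HarnessLib

/-!
# MaxContactCutBoundaryLedger — the g11 node «BoundaryLedger» wired to the route MaxContactCut BY NAME
(decomp-res node N58, lens-3 g11 sha256 d8eb129300d19b44; CRITIC-LEDGER line 94 CLEARED AS DECISION NODE; file 3 of 3)

The node's card is the module docstring of `Theorems.BoundaryLedgerModel` (§§1–3: the boundary-mass ledger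
`|r_{t+1}| = κ_t + (o_t − q)`, the single-component no-jump lemma, RIGIDITY OF FREE TAILS); the pieces, THE ONE
EQUIV and the laws are
`Theorems.BoundaryLedgerClasses` (§§4–6).  Route asides (MaxContactCut, `aside · rank 9`, refining 31770
`DefectWalksDeep`):
`BLNoCriticalFreePlateauxDeep` [UNDECIDED parent of the free column], `BLNoBareTailsDeep` [ρ = 0, KNOWN-MOD-PORT
CJS2020 Cor. 5.37,
rider p = 2], `BLNoLoadedCriticalPlateauxDeep` [1 ≤ ρ < q, ATTACKABLE], `BLSatDefectDeep` [the satellite column =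
THE residual].

Kernels (all by name, 0 sorry): the asides unfolded; **31770 ⟺ `BLNoCriticalFreePlateauxDeep ∧
BLSatDefectDeep`** EXACT, no port
(`defectWalksDeep_iff_ledger`); **`BLNoCriticalFreePlateauxDeep ⟺ BLNoBareTailsDeep ∧
BLNoLoadedCriticalPlateauxDeep`** EXACT
(`blNoCritical_iff_bare_loaded`); hence 31770 ⟺ the three cells (`defectWalksDeep_iff_cells`); the 2 × 2 grid
with N52 ItineraryCut:
31871 `ICNoRecurrentJumpDeep` ⟸ `BLSatDefectDeep` (`icNoRecurrentJumpDeep_of_blSat`), 31870 `ICNoPlateauDeep` ⟹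
`BLNoCriticalFreePlateauxDeep` (`blNoCritical_of_icNoPlateau`), the mixed cut 31770 ⟺ 31870 ∧ `BLSatDefectDeep`
(`defectWalksDeep_iff_plateau_sat`); necessity of every aside from 31770; the tree's all-`e` satellite class gives
`BLSatDefectDeep`
(`blSat_of_satDefect`); 31769 from the ledger pieces mod the dictionary port (`polyPureTowersDeep_of_ledger`).  ROOT
BY NAME is the
host's `MaxContactCutExponentLadder.closes` (aside ladder under 31770 / 30253 / 30256; the cone is unchanged — not restated).
(Sources: CossartJannsenSaito2020 Def. 5.34, Thm. 5.35, Cor. 5.37, §9; Hauser2010 §G; Moh1987; BenitoVillamayor2013 §7.)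
-/


namespace Summit.ResolutionOfSingularities.ResolutionOfSingularities.Theorems.MaxContactCutBoundaryLedger

open Literature.AlgebraicGeometry.Resolution
open Literature.AlgebraicGeometry.Resolution.PointBlowup
open Summit.ResolutionOfSingularities.ResolutionOfSingularities.Theses
open Summit.ResolutionOfSingularities.ResolutionOfSingularities.Theorems
open TightDefectClasses TightDefectStrongWalks ItineraryCutClasses BoundaryLedger

/-! ## The asides unfolded -/

/-- `BLNoCriticalFreePlateauxDeep` is the node's critical-free-plateau piece. [folklore] -/
theorem blNoCriticalFreePlateauxDeep_iff : MaxContactCut.BLNoCriticalFreePlateauxDeep ↔ NoCriticalFreePlateauxDeep := Iff.rfl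

/-- `BLNoBareTailsDeep` is the node's bare cell. [folklore] -/
theorem blNoBareTailsDeep_iff : MaxContactCut.BLNoBareTailsDeep ↔ NoBareTailsDeep := Iff.rfl

/-- `BLNoLoadedCriticalPlateauxDeep` is the node's loaded cell. [folklore] -/
theorem blNoLoadedCriticalPlateauxDeep_iff :
    MaxContactCut.BLNoLoadedCriticalPlateauxDeep ↔ NoLoadedCriticalPlateauxDeep := Iff.rfl

/-- `BLSatDefectDeep` is the node's satellite column. [folklore] -/
theorem blSatDefectDeep_iff : MaxContactCut.BLSatDefectDeep ↔ SatDefectWalksTerminateDeep := Iff.rfl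

/-! ## THE ONE EQUIV and the cells BY NAME -/

/-- **EXACT: 31770 ⟺ `BLNoCriticalFreePlateauxDeep ∧ BLSatDefectDeep`** (no port; kernel `free_tail_rigid`). [folklore] -/
theorem defectWalksDeep_iff_ledger :
    MaxContactCut.DefectWalksDeep ↔ MaxContactCut.BLNoCriticalFreePlateauxDeep ∧ MaxContactCut.BLSatDefectDeep :=
  defectDeep_iff_ledger

/-- **EXACT: the critical piece splits by the mass `ρ`** — bare (ρ = 0) and loaded (ρ ≥ 1). [folklore] -/
theorem blNoCritical_iff_bare_loaded :
    MaxContactCut.BLNoCriticalFreePlateauxDeep ↔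
      MaxContactCut.BLNoBareTailsDeep ∧ MaxContactCut.BLNoLoadedCriticalPlateauxDeep :=
  critical_iff_bare_loaded

/-- **31770 ⟺ the three cells** `BLNoBareTailsDeep ∧ BLNoLoadedCriticalPlateauxDeep ∧ BLSatDefectDeep` (EXACT,
no port). [folklore] -/
theorem defectWalksDeep_iff_cells :
    MaxContactCut.DefectWalksDeep ↔ MaxContactCut.BLNoBareTailsDeep ∧ MaxContactCut.BLNoLoadedCriticalPlateauxDeep ∧
      MaxContactCut.BLSatDefectDeep := by
  rw [defectWalksDeep_iff_ledger, blNoCritical_iff_bare_loaded, and_assoc]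

/-- 31770 from the two asides. [folklore] -/
theorem defectWalksDeep_of_ledger (h₁ : MaxContactCut.BLNoCriticalFreePlateauxDeep) (h₂ : MaxContactCut.BLSatDefectDeep) :
    MaxContactCut.DefectWalksDeep :=
  defectWalksDeep_iff_ledger.mpr ⟨h₁, h₂⟩

/-- Necessity: 31770 gives every aside of the node (no piece is stronger than the blocker). [folklore] -/
theorem asides_of_defectWalksDeep (h : MaxContactCut.DefectWalksDeep) :
    MaxContactCut.BLNoCriticalFreePlateauxDeep ∧ MaxContactCut.BLNoBareTailsDeep ∧
      MaxContactCut.BLNoLoadedCriticalPlateauxDeep ∧ MaxContactCut.BLSatDefectDeep :=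
  ⟨critical_of_deep h, bare_of_deep h, loaded_of_deep h, satDeep_of_deep h⟩

/-- The tree's all-exponent satellite class `SatDefectWalksTerminate` gives the deep satellite aside. [folklore] -/
theorem blSat_of_satDefect (h : SatDefectWalksTerminate) : MaxContactCut.BLSatDefectDeep :=
  satDeep_of_sat h

/-! ## The 2 × 2 grid with N52 ItineraryCut (31870 / 31871) BY NAME -/

/-- **31871 `ICNoRecurrentJumpDeep` ⟸ `BLSatDefectDeep`**: every jump is the child of a satellite move, so the
jump half of the
itinerary cut lies INSIDE the satellite column. [folklore] -/
theorem icNoRecurrentJumpDeep_of_blSat (h : MaxContactCut.BLSatDefectDeep) : MaxContactCut.ICNoRecurrentJumpDeep :=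
  noRecurrentJump_of_satDeep h

/-- **31870 `ICNoPlateauDeep` ⟹ `BLNoCriticalFreePlateauxDeep`**: critical free plateaux are plateaux. [folklore] -/
theorem blNoCritical_of_icNoPlateau (h : MaxContactCut.ICNoPlateauDeep) : MaxContactCut.BLNoCriticalFreePlateauxDeep :=
  critical_of_noPlateau h

/-- **The mixed EXACT cut: 31770 ⟺ 31870 `ICNoPlateauDeep` ∧ `BLSatDefectDeep`** — the residual is the
SATELLITE column. [folklore] -/
theorem defectWalksDeep_iff_plateau_sat :
    MaxContactCut.DefectWalksDeep ↔ MaxContactCut.ICNoPlateauDeep ∧ MaxContactCut.BLSatDefectDeep :=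
  defectDeep_iff_plateau_sat

/-- The decided cell of the grid at item level: (recurrent jumps) × (eventually free) is EMPTY — PROVED, no port.
[folklore] -/
theorem noFreeJumpWalksDeep : NoFreeJumpWalksDeep := noFreeJumpWalksDeep_holds

/-- The free column is critical — PROVED, no port. [folklore] -/
theorem freeTailsAreCriticalDeep : FreeTailsAreCriticalDeep := freeTailsAreCriticalDeep_holds

/-! ## The E-format column -/

/-- **31769 `PolyPureTowersDeep` from the two ledger asides** modulo the dictionary port (shade-0 walks PROVED in
the tree). [folklore] -/
theorem polyPureTowersDeep_of_ledger (hT : TowerDictionary) (h₁ : MaxContactCut.BLNoCriticalFreePlateauxDeep)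
    (h₂ : MaxContactCut.BLSatDefectDeep) : MaxContactCut.PolyPureTowersDeep :=
  polyPureTowersTerminateDeep_of_ledger hT strongWalksTerminate h₁ h₂

/-- Necessity from 30253 `NoForcedTowers` modulo the realisation port. [folklore] -/
theorem asides_of_noForcedTowers (hR : TowerRealisation) (h : MaxContactCut.NoForcedTowers) :
    MaxContactCut.BLNoCriticalFreePlateauxDeep ∧ MaxContactCut.BLSatDefectDeep :=
  defectWalksDeep_iff_ledger.mp (MaxContactCutTightDefect.pieces_of_noForcedTowers hR h).2.2.2.2.2

end Summit.ResolutionOfSingularities.ResolutionOfSingularities.Theorems.MaxContactCutBoundaryLedger
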